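import Mathlib.LinearAlgebra.TensorProduct.Basic
import Mathlib.Algebra.Order.Antidiag.Prod
import Mathlib.Algebra.BigOperators.Group.Finset.Sigma
import Mathlib.Data.Finset.NatAntidiagonal
import HarnessLib

/-!
# Künneth components, bookkeeping: injectivity on bidegree-indexed families from injectivity on antidiagonal families

Layer `Literature/Algebra/Homology` (pure linear algebra, Mathlib only; THEOREMS only). Cell `hodgecm-mathlib`, F-11
sub-line P1b, brick (G3) «Künneth on the product cover» — the ASSEMBLY half (B-p21 (g21), second hand under
F0P1b-p04 (g0)): the Künneth map of a product cover is delivered (F-K3 + bridge) as a statement about families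
`T : ∀ p : ℕ × ℕ, H^{p.1} ⊗ H^{p.2}` indexed by the antidiagonal of `n`; the consumer ★ `cup_one_one_surjective` (J3)
wants its `hinj` binder for families indexed by an ARBITRARY finite set `s ⊆ κ` with an injective bidegree map
`deg : κ → ℕ × ℕ`.  This file is the cast bookkeeping between the two shapes:

* `sum_dite_family_eq_sum_antidiagonal` — re-indexing a `deg`-indexed sum of components as an antidiagonal sum of the
  COLLECTED family `p ↦ ∑_{j ∈ s, deg j = p} t j` (transport along `deg j = p` by `cast`);
* `collect_apply_deg` — with `deg` injective on `s`, the collected family at `deg i` is `t i`;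
* **`eq_zero_of_sum_components_eq_zero`** — if antidiagonal families with vanishing sum of components vanish
  componentwise (injectivity of the Künneth map in the `T`-shape), then so do `deg`-indexed families (the `hinj` shape).

HC_CM is proved only modulo the 7 printed citations until rung 0 closes — nothing here bears on a summit statement.

## References
* [GortzWedhorn2023] U. Görtz, T. Wedhorn, *Algebraic Geometry II* (2023), Cor. 22.110 and (22.23) (Künneth formula,
  graded components).
* [StacksProject] The Stacks Project, Tag 0BED (Künneth formula).
-/

open scoped TensorProduct
open Finset

namespace Literature.Algebra.Homology

namespace KunnethComponents

variable {k : Type*} [CommRing k] {HA : ℕ → Type*} [∀ a, AddCommGroup (HA a)] [∀ a, Module k (HA a)]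
  {HS : Type*} [AddCommGroup HS] [Module k HS]

/-- Transport of a component along an equality of bidegrees. [cite: GortzWedhorn2023, (22.23)] -/
theorem cast_component_eq {p q : ℕ × ℕ} (h : p = q) (x : HA p.1 ⊗[k] HA p.2) :
    (cast (congrArg (fun r : ℕ × ℕ => HA r.1 ⊗[k] HA r.2) h) x : HA q.1 ⊗[k] HA q.2) = h ▸ x := by
  subst h
  rfl

/-- With `deg` injective on `s`, the collected family at `deg i` (`i ∈ s`) is `t i`. [cite: GortzWedhorn2023, (22.23)] -/
theorem collect_apply_deg {κ : Type*} (s : Finset κ) (deg : κ → ℕ × ℕ) (hdeg : Set.InjOn deg s)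
    (t : ∀ i, HA (deg i).1 ⊗[k] HA (deg i).2) {i : κ} (hi : i ∈ s) :
    (∑ j ∈ s, if h : deg j = deg i then cast (congrArg (fun r : ℕ × ℕ => HA r.1 ⊗[k] HA r.2) h) (t j) else 0) = t i := by
  classical
  rw [Finset.sum_eq_single i]
  · rw [dif_pos rfl, cast_eq]
  · intro j hj hji
    rw [dif_neg]
    exact fun h => hji (hdeg hj hi h)
  · intro h
    exact absurd hi h

/-- **Re-indexing**: the `deg`-indexed sum of the components `c_{deg i} (t i)` over `s` (degrees summing to `n` only) is
the antidiagonal sum of the components of the collected family. [cite: GortzWedhorn2023, (22.23)] -/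
theorem sum_dite_family_eq_sum_antidiagonal (n : ℕ) (c : ∀ p : ℕ × ℕ, p.1 + p.2 = n → HA p.1 ⊗[k] HA p.2 →ₗ[k] HS)
    {κ : Type*} (s : Finset κ) (deg : κ → ℕ × ℕ) (t : ∀ i, HA (deg i).1 ⊗[k] HA (deg i).2) :
    (∑ i ∈ s, if h : (deg i).1 + (deg i).2 = n then c (deg i) h (t i) else 0) =
      ∑ p ∈ antidiagonal n, if h : p.1 + p.2 = n then c p h
        (∑ j ∈ s, if h : deg j = p then cast (congrArg (fun r : ℕ × ℕ => HA r.1 ⊗[k] HA r.2) h) (t j) else 0) else 0 := by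
  classical
  -- push the linear maps `c p h` through the inner sums, then swap the sums
  have e1 : (∑ p ∈ antidiagonal n, if h : p.1 + p.2 = n then c p h
      (∑ j ∈ s, if h' : deg j = p then cast (congrArg (fun r : ℕ × ℕ => HA r.1 ⊗[k] HA r.2) h') (t j) else 0) else 0) =
      ∑ p ∈ antidiagonal n, ∑ j ∈ s, if h : p.1 + p.2 = n then
        (if h' : deg j = p then c p h (cast (congrArg (fun r : ℕ × ℕ => HA r.1 ⊗[k] HA r.2) h') (t j)) else 0) else 0 := by
    refine Finset.sum_congr rfl fun p hp => ?_
    have hpn : p.1 + p.2 = n := mem_antidiagonal.mp hp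
    rw [dif_pos hpn, map_sum]
    refine Finset.sum_congr rfl fun j _ => ?_
    rw [dif_pos hpn]
    by_cases h' : deg j = p
    · rw [dif_pos h', dif_pos h']
    · rw [dif_neg h', dif_neg h', map_zero]
  rw [e1, Finset.sum_comm]
  refine Finset.sum_congr rfl fun j _ => ?_
  -- for fixed `j` the inner sum over `p` has the single term `p = deg j`
  by_cases hjn : (deg j).1 + (deg j).2 = n
  · rw [dif_pos hjn, Finset.sum_eq_single (deg j)]
    · rw [dif_pos hjn, dif_pos rfl, cast_eq]
    · intro p _ hpj
      by_cases hpn : p.1 + p.2 = n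
      · rw [dif_pos hpn, dif_neg (fun h => hpj h.symm)]
      · rw [dif_neg hpn]
    · intro h
      exact absurd (mem_antidiagonal.mpr hjn) h
  · rw [dif_neg hjn]
    symm
    refine Finset.sum_eq_zero fun p hp => ?_
    have hpn : p.1 + p.2 = n := mem_antidiagonal.mp hp
    rw [dif_pos hpn, dif_neg]
    intro h
    exact hjn (by rw [h]; exact hpn)

/-- **INJECTIVITY TRANSPORT (the `hinj` shape of J3)**: if every antidiagonal family `T` with
`∑_{p} c_p (T p) = 0` vanishes componentwise, then for every finite family `t` indexed by `s ⊆ κ` with an injective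
bidegree map `deg`, `∑_{i ∈ s} c_{deg i} (t i) = 0` forces `t i = 0` whenever `(deg i).1 + (deg i).2 = n`.
[cite: GortzWedhorn2023, Cor. 22.110] [cite: StacksProject, Tag 0BED] -/
theorem eq_zero_of_sum_components_eq_zero (n : ℕ)
    (c : ∀ p : ℕ × ℕ, p.1 + p.2 = n → HA p.1 ⊗[k] HA p.2 →ₗ[k] HS)
    (hinjT : ∀ T : ∀ p : ℕ × ℕ, HA p.1 ⊗[k] HA p.2,
      (∑ p ∈ antidiagonal n, if h : p.1 + p.2 = n then c p h (T p) else 0) = 0 → ∀ p ∈ antidiagonal n, T p = 0)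
    {κ : Type*} (s : Finset κ) (deg : κ → ℕ × ℕ) (hdeg : Set.InjOn deg s)
    (t : ∀ i, HA (deg i).1 ⊗[k] HA (deg i).2)
    (ht : (∑ i ∈ s, if h : (deg i).1 + (deg i).2 = n then c (deg i) h (t i) else 0) = 0)
    {i : κ} (hi : i ∈ s) (hin : (deg i).1 + (deg i).2 = n) : t i = 0 := by
  rw [sum_dite_family_eq_sum_antidiagonal n c s deg t] at ht
  have h0 := hinjT (fun p => (∑ j ∈ s, if h : deg j = p then cast (congrArg (fun r : ℕ × ℕ => HA r.1 ⊗[k] HA r.2) h) (t j) else 0)) ht (deg i)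
    (mem_antidiagonal.mpr hin)
  rwa [collect_apply_deg s deg hdeg t hi] at h0

/-- **SURJECTIVITY (the `hsurj` shape of J3)** is the antidiagonal-family statement itself; recorded for symmetry:
`z = ∑_{p ∈ antidiagonal n} c_p (T p)` for some family `T`. [cite: GortzWedhorn2023, Cor. 22.110] -/
theorem exists_family_of_surjective (n : ℕ)
    (c : ∀ p : ℕ × ℕ, p.1 + p.2 = n → HA p.1 ⊗[k] HA p.2 →ₗ[k] HS)
    (hsurjT : ∀ z : HS, ∃ T : ∀ p : ℕ × ℕ, HA p.1 ⊗[k] HA p.2,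
      z = ∑ p ∈ antidiagonal n, if h : p.1 + p.2 = n then c p h (T p) else 0) (z : HS) :
    ∃ T : ∀ p : ℕ × ℕ, HA p.1 ⊗[k] HA p.2,
      z = ∑ p ∈ antidiagonal n, if h : p.1 + p.2 = n then c p h (T p) else 0 :=
  hsurjT z

end KunnethComponents

end Literature.Algebra.Homology
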